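import Literature.Computability.Cryptography.LWERegevEstimates
import HarnessLib

/-!
# Regev's decision-to-search reduction, II: random shifts of the secret and the core success bound

Topic `Computability/Cryptography` (LWE), grouping namespace `LWE.RegevReduction`, continuing
`LWERegevEstimates.lean` (the estimates of one shift). This file proves the probabilistic core of
Regev 2009, §4, Lemma 4.1 (Average-case to Worst-case) composed with Lemma 4.2 (Decision to
Search), for an arbitrary deterministic test `D` on blocks of `m` samples over `ℤ_q`, `q` prime:

* the outer experiment (`Outer`, `outerLaw`): `T` independent rounds, each a uniformly random shift
  `t_j` of the secret (so that `s + t_j` is uniform: "the distribution of `s + t` is uniform on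
  `ℤ_pⁿ`") together with the data of one shift; the output `output`: take a round `j*` of maximal
  score (any maximum selector, `IsMaxSel`) and return its candidate secret;
* **`output_eq`** (deterministic): if every round is accurate and some round has gap `≥ θ ≥ 8η`,
  the output is `s`;
* **`outerLaw_output_ne_le`**: `Pr[output ≠ s] ≤ T (nq+1)/(4Nη²) + (#{bad shifts}/qⁿ)^T`, where a
  shift `t` is bad when `gap(s,t) = |p(s+t) - p_U| < θ` (union bound over the rounds for accuracy,
  `innerLaw_compl_acc_le`; independence of the shifts for the second term);
* the averaging step of Lemma 4.1 (**`card_badShifts_le`**): if `D` has AVERAGE-case advantage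
  `|E_{s'} p(s') - p_U| ≥ ε` then at most a `1 - ε/2` fraction of the shifts have gap `< ε/2`
  ("distinguishes `A_{s,χ}` from `U` for a non-negligible fraction of all possible `s`");
* **`outerLaw_output_ne_le_of_advantage`**: with `θ = ε/2`, `16 η ≤ ε`:
  `Pr[output ≠ s] ≤ T (nq+1)/(4Nη²) + (1 - ε/2)^T`;
* the dictionary to the vocabulary of `LWE.lean`: `pAcc D P = (acceptProb (pure ∘ D) P).toReal`
  (`pAcc_eq_toReal_acceptProb`) and the average-case advantage of the deterministic distinguisher
  `pure ∘ D` (`distinguishingAdvantage_pure_eq`).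

Asymptotic parameter choices and the oracle machine are downstream (`regev_decision_to_search`,
`LWEHardness.lean`).

## References

* O. Regev, *On lattices, learning with errors, random linear codes, and cryptography*, J. ACM 56
  (2009), art. 34, §4, Lemmas 4.1–4.2 and their proofs (held: arXiv:2401.03703, p. 23).
  [cite: RegevLWE2009, §4 Lemma 4.1–4.2]
-/

noncomputable section

namespace Literature.Computability.Cryptography

namespace LWE

namespace RegevReduction

open _root_.MeasureTheory Finset Literature.Probability.Distributions
  Literature.Computability.Complexity
open scoped ENNReal

-- The sample space of the outer experiment is a deeply nested finite type
-- (`Fin T → (Fin n → ZMod q) × (Est → Fin N → Fin m → ZMod q × ((Fin n → ZMod q) × ZMod q))`);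
-- its `Fintype` instance exceeds the default instance-size bound (128) of typeclass synthesis.
set_option synthInstance.maxSize 512

variable {n q m N T : ℕ} [NeZero q]

/-! ### The outer experiment -/

/-- The data of the whole reduction: `T` rounds, each a shift `t_j` and the data of that shift.
[cite: RegevLWE2009, §4 (proof of Lemma 4.1: "Repeat the following … times. Choose a vector t ∈ ℤ_pⁿ uniformly at random …")] -/
abbrev Outer (n q m N T : ℕ) : Type := Fin T → Secret n q × Inner n q m N

variable (χ : PMF (ZMod q)) (s : Secret n q)

/-- The law of the outer experiment: rounds independent, shift uniform and independent of the
fresh pieces. [cite: RegevLWE2009, §4 (proof of Lemma 4.1)] -/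
def outerLaw (N T : ℕ) : PMF (Outer n q m N T) :=
  piLaw fun _ : Fin T => prodLaw (PMF.uniformOfFintype (Secret n q)) (innerLaw (m := m) χ s N)

/-- A *maximum selector*: a rule returning, for every `ℕ`-valued function on `Fin T`, a point where
it is maximal (e.g. the first maximiser). [folklore] -/
def IsMaxSel (sel : (Fin T → ℕ) → Fin T) : Prop :=
  ∀ (f : Fin T → ℕ) (j : Fin T), f j ≤ f (sel f)

variable {χ s}
variable (D : Block n q m → Bool)

/-- The round selected by the reduction: a round of maximal score. [cite: RegevLWE2009, §4 (proof of Lemma 4.1: "If the two estimates differ by more than … then we stop")] -/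
def selRound (selT : (Fin T → ℕ) → Fin T) (i₀ : Fin n) (Ω : Outer n q m N T) : Fin T :=
  selT fun j => score D (Ω j).1 (Ω j).2 i₀

/-- The output of the reduction: the candidate secret of the selected round.
[cite: RegevLWE2009, §4 Lemma 4.1–4.2] -/
def output (selT : (Fin T → ℕ) → Fin T) (sel : (ZMod q → ℕ) → ZMod q) (i₀ : Fin n)
    (Ω : Outer n q m N T) : Secret n q :=
  cand D (Ω (selRound D selT i₀ Ω)).1 sel (Ω (selRound D selT i₀ Ω)).2

/-- The bad shifts at threshold `θ`: gap `< θ`. [cite: RegevLWE2009, §4 (proof of Lemma 4.1)] -/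
def badShifts (χ : PMF (ZMod q)) (s : Secret n q) (θ : ℝ) : Finset (Secret n q) :=
  univ.filter fun t => ¬ θ ≤ gap (m := m) χ s t D

/-! ### Deterministic step -/

/-- **If every round is accurate and some shift is good, the output is the secret.** With
`8η ≤ θ`: the selected round has score `> Nθ - 2Nη`, hence gap `> θ - 4η ≥ 4η`, and then its
candidate is `s` (`cand_eq_of_acc`). [cite: RegevLWE2009, §4 (proofs of Lemmas 4.1, 4.2)] -/
theorem output_eq [Fact (1 < q)] (hN : 0 < N) {η θ : ℝ} (hθ : 8 * η ≤ θ)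
    {selT : (Fin T → ℕ) → Fin T} (hselT : IsMaxSel selT) {sel : (ZMod q → ℕ) → ZMod q}
    (hsel : IsMinSel sel) (i₀ : Fin n) (Ω : Outer n q m N T)
    (hacc : ∀ j, (Ω j).2 ∈ Acc χ s (Ω j).1 D N η) (hgood : ∃ j, θ ≤ gap χ s (Ω j).1 D) :
    output D selT sel i₀ Ω = s := by
  obtain ⟨j₀, hj₀⟩ := hgood
  set f : Fin T → ℕ := fun j => score D (Ω j).1 (Ω j).2 i₀ with hf
  have hNpos : (0 : ℝ) < N := by exact_mod_cast hN
  have h₀ := abs_score_sub_lt (hacc j₀) i₀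
  have h₁ := abs_score_sub_lt (hacc (selT f)) i₀
  rw [abs_lt] at h₀ h₁
  have hmax : (f j₀ : ℝ) ≤ f (selT f) := by exact_mod_cast hselT f j₀
  change (score D (Ω j₀).1 (Ω j₀).2 i₀ : ℝ) ≤ score D (Ω (selT f)).1 (Ω (selT f)).2 i₀ at hmax
  have hgap : 4 * η ≤ gap χ s (Ω (selT f)).1 D := by
    have hN4 : (N : ℝ) * (θ - 4 * η) < N * gap χ s (Ω (selT f)).1 D := by
      have := mul_le_mul_of_nonneg_left hj₀ hNpos.le
      nlinarith [h₀.1, h₁.2, hmax, this]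
    have := lt_of_mul_lt_mul_left hN4 hNpos.le
    linarith
  exact cand_eq_of_acc (hacc (selT f)) hsel hgap

/-! ### The failure probability -/

omit [NeZero q] in
/-- `q` prime gives `1 < q` as a `Fact` (local bridge for the instance arguments). [folklore] -/
theorem fact_one_lt_of_prime [Fact q.Prime] : Fact (1 < q) := ⟨(Fact.out : q.Prime).one_lt⟩

/-- **Core failure bound**: `Pr[output ≠ s] ≤ T(nq+1)/(4Nη²) + (#bad/qⁿ)^T` — a union bound over
the rounds for their accuracy, and independence of the `T` uniform shifts for "all shifts bad".
[cite: RegevLWE2009, §4 (proofs of Lemmas 4.1, 4.2)] -/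
theorem outerLaw_output_ne_le [Fact q.Prime] (hN : 0 < N) {η θ : ℝ} (hη : 0 < η) (hθ : 8 * η ≤ θ)
    {selT : (Fin T → ℕ) → Fin T} (hselT : IsMaxSel selT) {sel : (ZMod q → ℕ) → ZMod q}
    (hsel : IsMinSel sel) (i₀ : Fin n) :
    (outerLaw (m := m) χ s N T).toOuterMeasure {Ω | output D selT sel i₀ Ω ≠ s} ≤
      ENNReal.ofReal (T * ((n * q + 1) / (4 * N * η ^ 2))) +
        ENNReal.ofReal ((((badShifts (m := m) D χ s θ).card : ℝ) / Fintype.card (Secret n q)) ^ T) := by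
  classical
  haveI : Fact (1 < q) := fact_one_lt_of_prime
  set R : PMF (Secret n q × Inner n q m N) :=
    prodLaw (PMF.uniformOfFintype (Secret n q)) (innerLaw (m := m) χ s N) with hR
  set μ : Measure (Secret n q × Inner n q m N) := R.toMeasure with hμ
  -- the two escape events
  set C : Set (Secret n q × Inner n q m N) := {p | ¬ θ ≤ gap χ s p.1 D} with hC
  set S : Set (Secret n q × Inner n q m N) := {p | p.2 ∉ Acc χ s p.1 D N η} with hS
  set A : Set (Outer n q m N T) := Set.univ.pi fun _ : Fin T => C with hA
  set B : Set (Outer n q m N T) := ⋃ j, (Function.eval j) ⁻¹' S with hB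
  have hsub : {Ω : Outer n q m N T | output D selT sel i₀ Ω ≠ s} ⊆ A ∪ B := by
    intro Ω hΩ
    by_contra hAB
    simp only [Set.mem_union, not_or, hA, hB, Set.mem_univ_pi, Set.mem_iUnion, Set.mem_preimage,
      Function.eval, not_forall, not_exists, hC, hS, Set.mem_setOf_eq, not_not] at hAB
    obtain ⟨⟨j₀, hj₀⟩, hacc⟩ := hAB
    exact hΩ (output_eq D hN hθ hselT hsel i₀ Ω hacc ⟨j₀, hj₀⟩)
  -- measure of "all shifts bad"
  have hμC : μ C = ENNReal.ofReal (((badShifts (m := m) D χ s θ).card : ℝ) / Fintype.card (Secret n q)) := by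
    have hCeq : C = Prod.fst ⁻¹' ((badShifts (m := m) D χ s θ : Finset (Secret n q)) : Set (Secret n q)) := by
      ext p
      simp [hC, badShifts]
    rw [hμ, PMF.toMeasure_apply_eq_toOuterMeasure, hCeq, ← PMF.toOuterMeasure_map_apply, hR,
      prodLaw_map_fst, PMF.toOuterMeasure_apply_finset]
    simp only [PMF.uniformOfFintype_apply, Finset.sum_const, nsmul_eq_mul]
    have hcard : (0 : ℝ) < Fintype.card (Secret n q) := by exact_mod_cast Fintype.card_pos
    rw [ENNReal.ofReal_div_of_pos hcard, ENNReal.ofReal_natCast, ENNReal.ofReal_natCast,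
      div_eq_mul_inv]
  have hμA : Measure.pi (fun _ : Fin T => μ) A =
      ENNReal.ofReal ((((badShifts (m := m) D χ s θ).card : ℝ) / Fintype.card (Secret n q)) ^ T) := by
    rw [hA, Measure.pi_pi, Finset.prod_const, Finset.card_univ, Fintype.card_fin, hμC,
      ← ENNReal.ofReal_pow (by positivity)]
  -- measure of "some round inaccurate"
  have hμS : μ S ≤ ENNReal.ofReal ((n * q + 1) / (4 * N * η ^ 2)) := by
    rw [hμ, hR, toMeasure_prodLaw, Measure.prod_apply S.to_countable.measurableSet]
    calc ∫⁻ t, (innerLaw (m := m) χ s N).toMeasure (Prod.mk t ⁻¹' S)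
          ∂(PMF.uniformOfFintype (Secret n q)).toMeasure
        ≤ ∫⁻ _t, ENNReal.ofReal ((n * q + 1) / (4 * N * η ^ 2))
          ∂(PMF.uniformOfFintype (Secret n q)).toMeasure := by
          refine lintegral_mono fun t => ?_
          rw [PMF.toMeasure_apply_eq_toOuterMeasure,
            show Prod.mk t ⁻¹' S = (Acc χ s t D N η)ᶜ from rfl]
          exact innerLaw_compl_acc_le χ s t D hN hη
      _ = ENNReal.ofReal ((n * q + 1) / (4 * N * η ^ 2)) := by
          rw [lintegral_const, measure_univ, mul_one]
  have hμB : Measure.pi (fun _ : Fin T => μ) B ≤ ENNReal.ofReal (T * ((n * q + 1) / (4 * N * η ^ 2))) := by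
    calc Measure.pi (fun _ : Fin T => μ) B ≤ ∑ j, Measure.pi (fun _ : Fin T => μ) ((Function.eval j) ⁻¹' S) :=
          measure_iUnion_fintype_le _ _
      _ = ∑ _j : Fin T, μ S := Finset.sum_congr rfl fun j _ =>
          (measurePreserving_eval (fun _ : Fin T => μ) j).measure_preimage
            S.to_countable.measurableSet.nullMeasurableSet
      _ ≤ ∑ _j : Fin T, ENNReal.ofReal ((n * q + 1) / (4 * N * η ^ 2)) :=
          Finset.sum_le_sum fun j _ => hμS
      _ = ENNReal.ofReal (T * ((n * q + 1) / (4 * N * η ^ 2))) := by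
          rw [Finset.sum_const, Finset.card_univ, Fintype.card_fin, nsmul_eq_mul,
            ← ENNReal.ofReal_natCast, ← ENNReal.ofReal_mul (Nat.cast_nonneg _)]
  -- assemble
  rw [outerLaw, toOuterMeasure_piLaw_apply]
  calc Measure.pi (fun _ : Fin T => μ) {Ω | output D selT sel i₀ Ω ≠ s}
      ≤ Measure.pi (fun _ : Fin T => μ) (A ∪ B) := measure_mono hsub
    _ ≤ Measure.pi (fun _ : Fin T => μ) A + Measure.pi (fun _ : Fin T => μ) B := measure_union_le _ _
    _ ≤ _ := by
        rw [hμA, add_comm]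
        exact add_le_add hμB le_rfl

/-! ### The averaging step of Lemma 4.1 -/

/-- **Averaging**: an average-case advantage `ε ≤ |E_{s'} p(s') - p_U|` (uniform `s'`) forces at
least an `ε/2` fraction of the secrets `s' = s + t` to have gap `|p(s') - p_U| ≥ ε/2`, i.e. at
most a `1 - ε/2` fraction of bad shifts ("distinguishes `A_{s,χ}` from `U` for a non-negligible
fraction of all possible `s`"). [cite: RegevLWE2009, §4 Lemma 4.1 (hypothesis) with §2 (distinguisher)] -/
theorem card_badShifts_le {ε : ℝ}
    (hε : ε ≤ |(∑ s' : Secret n q, pAcc D (lweSamples χ s' m)) / Fintype.card (Secret n q) -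
      pAcc D (uniformSamples (Fin n) (ZMod q) m)|) :
    ((badShifts (m := m) D χ s (ε / 2)).card : ℝ) ≤ (1 - ε / 2) * Fintype.card (Secret n q) := by
  classical
  set K : ℝ := (Fintype.card (Secret n q) : ℝ) with hK
  have hKpos : 0 < K := by rw [hK]; exact_mod_cast Fintype.card_pos
  set pU : ℝ := pAcc D (uniformSamples (Fin n) (ZMod q) m) with hpU
  set g : Secret n q → ℝ := fun t => gap (m := m) χ s t D with hg
  -- reindex the average along `s' = s + t`
  have hsum : ∑ s' : Secret n q, pAcc D (lweSamples χ s' m) =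
      ∑ t : Secret n q, pAcc D (lweSamples χ (s + t) m) :=
    (Fintype.sum_equiv (Equiv.addLeft s) _ _ fun t => rfl).symm
  -- `ε ≤ (1/K) ∑_t g t`
  have h1 : ε ≤ (∑ t, g t) / K := by
    have hrw : (∑ t : Secret n q, pAcc D (lweSamples χ (s + t) m)) / K - pU =
        (∑ t : Secret n q, (pAcc D (lweSamples χ (s + t) m) - pU)) / K := by
      rw [Finset.sum_sub_distrib, Finset.sum_const, Finset.card_univ, nsmul_eq_mul, ← hK, sub_div,
        mul_div_cancel_left₀ pU hKpos.ne']
    refine hε.trans ?_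
    rw [hsum, hrw, abs_div, abs_of_pos hKpos]
    exact div_le_div_of_nonneg_right (Finset.abs_sum_le_sum_abs _ _) hKpos.le
  -- split the sum into good and bad shifts
  set bad := badShifts (m := m) D χ s (ε / 2) with hbad
  set good := univ.filter fun t : Secret n q => ε / 2 ≤ g t with hgood
  have hsplit : ∑ t, g t = ∑ t ∈ good, g t + ∑ t ∈ bad, g t := by
    rw [hgood, hbad, badShifts, ← Finset.sum_filter_add_sum_filter_not univ (fun t => ε / 2 ≤ g t)]
  have hgood_le : ∑ t ∈ good, g t ≤ (good.card : ℝ) := by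
    calc ∑ t ∈ good, g t ≤ ∑ _t ∈ good, (1 : ℝ) := Finset.sum_le_sum fun t _ => by
            rw [hg]
            unfold gap
            rw [abs_le]
            constructor <;> linarith [pAcc_nonneg D (lweSamples χ (s + t) m),
              pAcc_le_one D (lweSamples χ (s + t) m),
              pAcc_nonneg D (uniformSamples (Fin n) (ZMod q) m),
              pAcc_le_one D (uniformSamples (Fin n) (ZMod q) m)]
      _ = good.card := by rw [Finset.sum_const, nsmul_eq_mul, mul_one]
  have hbad_le : ∑ t ∈ bad, g t ≤ (ε / 2) * (bad.card : ℝ) := by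
    calc ∑ t ∈ bad, g t ≤ ∑ _t ∈ bad, ε / 2 := Finset.sum_le_sum fun t ht => by
            rw [hbad, badShifts, Finset.mem_filter] at ht
            exact (not_le.1 ht.2).le
      _ = (ε / 2) * bad.card := by rw [Finset.sum_const, nsmul_eq_mul, mul_comm]
  have hcards : (good.card : ℝ) + bad.card = K := by
    have h := Finset.card_filter_add_card_filter_not (s := (univ : Finset (Secret n q)))
      (fun t => ε / 2 ≤ g t)
    rw [Finset.card_univ] at h
    rw [hK, ← h, hgood, hbad, badShifts]
    push_cast
    rfl
  have hbadK : (bad.card : ℝ) ≤ K := by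
    have : (0 : ℝ) ≤ good.card := Nat.cast_nonneg _
    linarith
  -- conclude
  rw [le_div_iff₀ hKpos] at h1
  nlinarith [hsplit, hgood_le, hbad_le, hcards, hbadK, h1]

/-- **Core success bound of Regev's reduction (Lemmas 4.1 + 4.2), non-asymptotic form.** For a
deterministic test `D` with average-case advantage `≥ ε` against `LWE_{q,χ}` on `m` samples
(`q` prime), accuracy `η` with `16 η ≤ ε`, `N ≥ 1` repetitions and `T` random shifts, the
reduction outputs the secret `s` except with probability
`≤ T (nq+1)/(4Nη²) + (1 - ε/2)^T`, for every `s`. [cite: RegevLWE2009, §4 Lemma 4.1–4.2] -/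
theorem outerLaw_output_ne_le_of_advantage [Fact q.Prime] (hN : 0 < N) {η ε : ℝ} (hη : 0 < η)
    (hηε : 16 * η ≤ ε)
    (hε : ε ≤ |(∑ s' : Secret n q, pAcc D (lweSamples χ s' m)) / Fintype.card (Secret n q) -
      pAcc D (uniformSamples (Fin n) (ZMod q) m)|)
    {selT : (Fin T → ℕ) → Fin T} (hselT : IsMaxSel selT) {sel : (ZMod q → ℕ) → ZMod q}
    (hsel : IsMinSel sel) (i₀ : Fin n) :
    (outerLaw (m := m) χ s N T).toOuterMeasure {Ω | output D selT sel i₀ Ω ≠ s} ≤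
      ENNReal.ofReal (T * ((n * q + 1) / (4 * N * η ^ 2)) + (1 - ε / 2) ^ T) := by
  have hKpos : (0 : ℝ) < Fintype.card (Secret n q) := by exact_mod_cast Fintype.card_pos
  have hfrac : ((badShifts (m := m) D χ s (ε / 2)).card : ℝ) / Fintype.card (Secret n q) ≤ 1 - ε / 2 := by
    rw [div_le_iff₀ hKpos]
    exact card_badShifts_le D hε
  have hpow : (((badShifts (m := m) D χ s (ε / 2)).card : ℝ) / Fintype.card (Secret n q)) ^ T ≤
      (1 - ε / 2) ^ T := pow_le_pow_left₀ (by positivity) hfrac T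
  have h := outerLaw_output_ne_le (χ := χ) (s := s) D hN hη (θ := ε / 2) (by linarith) hselT hsel i₀
  refine h.trans ?_
  rw [← ENNReal.ofReal_add (by positivity) (by positivity)]
  exact ENNReal.ofReal_le_ofReal (add_le_add le_rfl hpow)

/-! ### Dictionary to `LWE.lean` -/

omit [NeZero q] in
/-- `pAcc D P` is the acceptance probability, in the sense of `LWE.acceptProb`, of the
deterministic distinguisher `b ↦ pure (D b)`. [folklore] -/
theorem pAcc_eq_toReal_acceptProb (P : PMF (Block n q m)) :
    pAcc D P = (acceptProb (fun b => PMF.pure (D b)) P).toReal := by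
  unfold pAcc acceptProb
  congr 1
  rw [PMF.toOuterMeasure_apply, PMF.bind_apply]
  refine tsum_congr fun b => ?_
  by_cases hb : D b = true
  · rw [Set.indicator_of_mem (show b ∈ {b | D b = true} from hb), PMF.pure_apply, if_pos hb.symm, mul_one]
  · rw [Set.indicator_of_notMem (show b ∉ {b | D b = true} from hb), PMF.pure_apply,
      if_neg (fun h => hb h.symm), mul_zero]

/-- The average-case advantage of the deterministic distinguisher `pure ∘ D` in terms of `pAcc`:
`|(1/qⁿ) ∑_{s'} p(s') - p_U|`. [cite: RegevLWE2009, §4; Peikert 2016, Def. 4.2.2] -/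
theorem distinguishingAdvantage_pure_eq (χ : PMF (ZMod q)) :
    distinguishingAdvantage χ m (fun b : Block n q m => PMF.pure (D b)) =
      |(∑ s' : Secret n q, pAcc D (lweSamples χ s' m)) / Fintype.card (Secret n q) -
        pAcc D (uniformSamples (Fin n) (ZMod q) m)| := by
  rw [distinguishingAdvantage, toReal_acceptProb_lweSamplesUniformSecret, ← pAcc_eq_toReal_acceptProb]
  congr 2
  rw [Finset.sum_div]
  refine Finset.sum_congr rfl fun s' _ => ?_
  rw [← pAcc_eq_toReal_acceptProb, PMF.uniformOfFintype_apply, ENNReal.toReal_inv,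
    ENNReal.toReal_natCast, inv_mul_eq_div]

end RegevReduction

end LWE

end Literature.Computability.Cryptography

end
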